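import Literature.AlgebraicGeometry.Resolution.SmoothPointEtaleFactorisation
import Mathlib.AlgebraicGeometry.Morphisms.Etale
import Mathlib.AlgebraicGeometry.AlgClosed.Basic
import HarnessLib

/-!
# Étale neighbourhoods with a section through a smooth rational point (EGA IV 17.16.3)

Topic: `Literature/AlgebraicGeometry/Resolution`. The geometric form of the pointwise étale
lifting lemma `exists_etale_factorisation_of_smooth` (`SmoothPointEtaleFactorisation.lean`,
Stacks 07M7 at a point): for a morphism `f : X → Y` of schemes locally of finite type over an
algebraically closed field `k`, locally of finite presentation, and a CLOSED point `x` of `X` at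
which `f` is smooth, there are an affine scheme `U`, an ÉTALE morphism `g : U → Y`, a
`Y`-morphism `σ : U → X` (`σ ≫ f = g`) and a `k`-point of `U` which `σ` sends to the `k`-point
of `X` at `x` (`exists_etale_nhd_section`). Classical statement: a smooth morphism admits
sections étale-locally on the base through any rational point of a fibre (EGA IV₄ 17.16.3;
Milne, *Étale cohomology*, Prop. 3.26).

This is the replacement, in de Jong 1996, 4.12 ("`Y' → ℙ^{d-1}` is (finite) étale, in view of
property (ii) b) of the lemma": the smooth locus of `f` is dense in all fibres), of the sections
over the strict henselisation `Spec 𝒪^{sh}_{ℙ, y} → X'` through smooth points of the fibre: the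
sections exist already over an étale neighbourhood of `y`.

Proof: Mathlib's `exists_smooth_of_formallySmooth_stalk` provides affine opens `U₀ ∋ f x` of `Y`
and `V₀ ∋ x` of `X` with `Γ(Y, U₀) → Γ(X, V₀)` smooth; the `k`-points at `x` and `f x`
(`pointOfClosedPoint`, `k` algebraically closed) are ring maps `χ₀ : Γ(X, V₀) → k`,
`a₀ : Γ(Y, U₀) → k` (`exists_SpecMap_comp_fromSpec_eq`), compatible, with `a₀` surjective (it is
a retraction of `k → Γ(Y, U₀)`); `exists_etale_factorisation_of_smooth` factors `χ₀` through an
étale `Γ(Y, U₀)`-algebra `A'`, and `U = Spec A'`. [folklore]; no definitions, no named facts.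

## Sources

* A. Grothendieck, J. Dieudonné, EGA IV₄, Cor. 17.16.3 (ii). [Grothendieck1967]
* J. S. Milne, *Étale cohomology*, Prop. 3.26. The Stacks Project, Tag 07M7, Tag 055U.
* A. J. de Jong, *Smoothness, semi-stability and alterations*, Publ. Math. IHÉS 83 (1996), 4.12,
  p. 68 (the use). [DeJong1996]
-/

noncomputable section

open CategoryTheory CategoryTheory.Limits AlgebraicGeometry TopologicalSpace

namespace Literature.AlgebraicGeometry.Resolution

universe u

/-- A morphism `p : Spec K → X` landing in an affine open `V` is `Spec` of a ring map
`Γ(X, V) → K` followed by `Spec Γ(X, V) → X`. [folklore] -/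
theorem exists_SpecMap_comp_fromSpec_eq {K : CommRingCat.{u}} {X : Scheme.{u}}
    (p : Spec K ⟶ X) {V : X.Opens} (hV : IsAffineOpen V) (hp : Set.range p ⊆ (V : Set X)) :
    ∃ χ : Γ(X, V) ⟶ K, Spec.map χ ≫ hV.fromSpec = p := by
  have hr : Set.range p ⊆ Set.range hV.fromSpec := by rwa [hV.range_fromSpec]
  refine ⟨Spec.preimage (IsOpenImmersion.lift hV.fromSpec p hr), ?_⟩
  rw [Spec.map_preimage, IsOpenImmersion.lift_fac]

/-- `Spec` of an étale ring map is étale. [folklore] -/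
theorem etale_SpecMap_of_etale {A A' : Type u} [CommRing A] [CommRing A'] [Algebra A A']
    [Algebra.Etale A A'] :
    Etale (Spec.map (CommRingCat.ofHom (algebraMap A A'))) := by
  rw [HasRingHomProperty.Spec_iff (P := @Etale), CommRingCat.hom_ofHom, RingHom.etale_algebraMap]
  infer_instance

/-- **Étale neighbourhood with a section through a smooth closed point** (EGA IV₄ 17.16.3 over
an algebraically closed field): for `f : X → Y` locally of finite presentation between schemes
locally of finite type over `k = k̄`, and a closed point `x ∈ X` in the smooth locus of `f`,
there exist an affine `U`, an étale `g : U → Y`, a `Y`-morphism `σ : U → X` and a `k`-point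
`pu` of `U` with `pu ≫ σ =` the `k`-point of `X` at `x`. (So `g` maps `pu` to the `k`-point at
`f x`, and `σ` is a section of `X ×_Y U → U` through `x`.) [folklore] -/
theorem exists_etale_nhd_section {k : Type u} [Field k] [IsAlgClosed k] {X Y : Scheme.{u}}
    (gY : Y ⟶ Spec (.of k)) (f : X ⟶ Y) [LocallyOfFinitePresentation f]
    [LocallyOfFiniteType (f ≫ gY)] {x : X} (hx : x ∈ f.smoothLocus)
    (hxc : IsClosed ({x} : Set X)) :
    ∃ (U : Scheme.{u}) (_ : IsAffine U) (g : U ⟶ Y) (_ : Etale g) (σ : U ⟶ X)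
      (pu : Spec (.of k) ⟶ U), σ ≫ f = g ∧ pu ≫ σ = pointOfClosedPoint (f ≫ gY) x hxc := by
  -- smooth affine charts around `x` and `f x`
  obtain ⟨U₀, hU₀, V₀, hV₀, hVU, hxV, hsm⟩ := exists_smooth_of_formallySmooth_stalk f x hx
  -- the `k`-points at `x` and `f x` as ring maps on the charts
  set px := pointOfClosedPoint (f ≫ gY) x hxc with hpx
  have hpx_range : Set.range px ⊆ (V₀ : Set X) := by
    rintro _ ⟨a, rfl⟩
    rw [hpx, pointOfClosedPoint_apply]
    exact hxV
  obtain ⟨χ₀, hχ₀⟩ := exists_SpecMap_comp_fromSpec_eq px hV₀ hpx_range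
  have hpy_range : Set.range (px ≫ f) ⊆ (U₀ : Set Y) := by
    rintro _ ⟨a, rfl⟩
    rw [Scheme.Hom.comp_apply, hpx, pointOfClosedPoint_apply]
    exact hVU hxV
  obtain ⟨a₀, ha₀⟩ := exists_SpecMap_comp_fromSpec_eq (px ≫ f) hU₀ hpy_range
  -- compatibility of the two evaluations with `f^♯`
  have hcompat : f.appLE U₀ V₀ hVU ≫ χ₀ = a₀ := by
    apply Spec.map_injective
    rw [← cancel_mono hU₀.fromSpec, Spec.map_comp, Category.assoc,
      IsAffineOpen.SpecMap_appLE_fromSpec f hU₀ hV₀ hVU, ← Category.assoc, hχ₀, ha₀]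
  -- `a₀` is surjective: it is a retraction of `k → Γ(Y, U₀)`
  have hret : (Scheme.ΓSpecIso (.of k)).inv ≫ gY.appLE ⊤ U₀ le_top ≫ a₀ = 𝟙 _ := by
    apply Spec.map_injective
    have h1 : (px ≫ f) ≫ gY = 𝟙 _ := by rw [Category.assoc, hpx, pointOfClosedPoint_comp]
    rw [Spec.map_id, Spec.map_comp, Spec.map_comp, ← Scheme.isoSpec_Spec_inv,
      ← IsAffineOpen.fromSpec_top, Category.assoc,
      IsAffineOpen.SpecMap_appLE_fromSpec gY (isAffineOpen_top _) hU₀ le_top, ← Category.assoc,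
      ha₀, h1]
  have ha₀_surj : Function.Surjective a₀ := fun c => by
    have h := congrArg (fun φ : CommRingCat.of k ⟶ CommRingCat.of k => φ.hom c) hret
    simp only [CommRingCat.hom_comp, RingHom.comp_apply, CommRingCat.hom_id, RingHom.id_apply] at h
    exact ⟨_, h⟩
  -- the algebra
  algebraize [(f.appLE U₀ V₀ hVU).hom]
  letI : Algebra Γ(Y, U₀) k := a₀.hom.toAlgebra
  let χ : Γ(X, V₀) →ₐ[Γ(Y, U₀)] k :=
    { toRingHom := χ₀.hom
      commutes' := fun a => by
        change χ₀.hom ((f.appLE U₀ V₀ hVU).hom a) = a₀.hom a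
        rw [← hcompat]
        rfl }
  have hK : ∀ c : k, ∃ a s : Γ(Y, U₀), algebraMap Γ(Y, U₀) k s ≠ 0 ∧
      algebraMap Γ(Y, U₀) k s * c = algebraMap Γ(Y, U₀) k a := fun c => by
    obtain ⟨a, ha⟩ := ha₀_surj c
    exact ⟨a, 1, by simp, by rw [map_one, one_mul]; exact ha.symm⟩
  obtain ⟨A', _, _, hEt, τ, ψ, hψτ⟩ := exists_etale_factorisation_of_smooth hK χ
  -- the étale neighbourhood `U = Spec A'`, the section and the point
  let ιA : Γ(Y, U₀) ⟶ CommRingCat.of A' := CommRingCat.ofHom (algebraMap Γ(Y, U₀) A')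
  haveI : Etale (Spec.map ιA) := etale_SpecMap_of_etale
  let g : Spec (CommRingCat.of A') ⟶ Y := Spec.map ιA ≫ hU₀.fromSpec
  let σ : Spec (CommRingCat.of A') ⟶ X := Spec.map (CommRingCat.ofHom τ.toRingHom) ≫ hV₀.fromSpec
  let pu : Spec (CommRingCat.of k) ⟶ Spec (CommRingCat.of A') :=
    Spec.map (CommRingCat.ofHom ψ.toRingHom)
  have hτ : f.appLE U₀ V₀ hVU ≫ CommRingCat.ofHom τ.toRingHom = ιA := by
    ext a
    change τ ((f.appLE U₀ V₀ hVU).hom a) = algebraMap Γ(Y, U₀) A' a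
    exact τ.commutes a
  have hψ : CommRingCat.ofHom τ.toRingHom ≫ CommRingCat.ofHom ψ.toRingHom = χ₀ := by
    ext b
    change ψ (τ b) = χ₀.hom b
    have := congrArg (fun φ : Γ(X, V₀) →ₐ[Γ(Y, U₀)] k => φ b) hψτ
    exact this
  refine ⟨Spec (CommRingCat.of A'), inferInstance, g, inferInstance, σ, pu, ?_, ?_⟩
  · simp only [σ, g, Category.assoc]
    rw [← IsAffineOpen.SpecMap_appLE_fromSpec f hU₀ hV₀ hVU, ← Spec.map_comp_assoc, hτ]
  · simp only [pu, σ]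
    rw [← Spec.map_comp_assoc, hψ, hχ₀]

end Literature.AlgebraicGeometry.Resolution

end
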